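import Mathlib
import Summits.Langlands.Langlands.Theses.PicardMuOrdinary
import Literature.NumberTheory.GaloisRepresentations.CubicResidueSymbol
import Literature.NumberTheory.GaloisRepresentations.GaloisRep
import Literature.NumberTheory.Automorphic.ReciprocityGLnProofs
import Literature.AlgebraicGeometry.Motives.PicardCurveMuOrdinaryReduction

/-!
# Line `weight-blind-lambda-adic-rt` — checked skeleton for the crux
`Summit.Langlands.Langlands.Theses.PicardMuOrdinary.MuOrdinaryFamilyRT` (stmt-Langlands-13757)

Planner crux-plan (round 1), idea card `Ideas/weight-blind-lambda-adic-rt.md`, triage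
`TRIAGE-r1-1.md`.  Six registered stubs `stub_*` (sorried; each a genuine lemma of the line) and the
kernel-checked composition `MuOrdinaryFamilyRT_of : MuOrdinaryFamilyRT` (pure logic; the only
`sorry`s are inside the stubs).  See `Lines/weight-blind-lambda-adic-rt.md` for the line card.

Notation in comments: `K = ℚ(ω) = CyclotomicField 3 ℚ`, `λ = (1 - ω)` its prime above `3`,
`ρ_C : Γ_K → GL₃(ℚ̄₃)` the `λ`-adic representation of the Picard curve `C : y³ = f(x)`,
`a_𝔭(f) = picardTrace f 𝔭`, `F' = K(√d)` an auxiliary quadratic extension in which `λ` SPLITS with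
`F'_w = K_λ` (`d = 6`: `ℚ₃(√6) = ℚ₃(√-3)`), `σ = Gal(F'/K)`.

Shape of the line (σ-fixed Λ-adic pro-automorphy through the compact unitary group over `F'`):
* `stub_picardGaloisInput` — the Galois input: `ρ_C` exists, is absolutely irreducible (image of
  `ρ̄_C` is the reflection representation of `S₄`/`A₄`), unramified outside a finite `S₀ ∋ λ`, with
  GEOMETRIC Frobenius trace `ι⁻¹(e(a_𝔭(f)))` at every `𝔭 ∉ S₀` (Tate module of the Picard Jacobian,
  `ω`-eigenpart, Lefschetz; the cubic-character point count of `CubicResidueSymbol`).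
* `stub_sigmaFixedOrdinaryFamily` — THE LEVER (hardest; the card's K1 + K2 + the triage's (β)):
  for `f` in the MAIN CLASS (`HasMuOrdinaryReductionAtThree f`, image of `ρ̄_C|Γ_K` equal to `S₄`)
  there is a finite, dominating `Λ`-adic family through `ρ_C` OVER `K` whose arithmetic points are
  automorphic after restriction to `F'`: a Noetherian normal domain `Λ` (intended
  `Λ_K ≅ 𝒪⟦X₁,X₂,X₃⟧`, the polarized ordinary weight algebra of `U(3)_{K/ℚ}`), a finite
  `Λ`-algebra `R` (intended: the polarized `Λ`-ordinary deformation ring `R_K` of `ρ̄_C`, or its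
  Hecke quotient), a trace function `T : Γ_K → R` specialising to `tr ρ_C` at a point `x`, a prime
  `𝔮 ⊆ ker x` of `R` with `𝔮 ∩ Λ = 0` ((β): the component through `x_C` DOMINATES weight space), a
  set `D` of `E`-rational arithmetic (regular dominant) weights accumulating at the weight of
  `x`, and CLASSICALITY of every `D`-point `y`: `y ∘ T = tr ρ_y` for a `ρ_y : Γ_K → GL₃(ℚ̄₃)`,
  absolutely irreducible on `Γ_{F'}`, with `ρ_y|Γ_{F'}` the Galois representation of a regular
  algebraic cuspidal `P'_y` of `GL₃(𝔸_{F'})` unramified outside `S'` (Geraghty-type `Λ`-adic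
  ordinary `R^{red} = T` for the definite `U(3)_{F'/ℚ(√d)}` at the now-SPLIT prime `3`, Hida
  control, Labesse base change; the σ-fixed/`K`-rational upgrade (β) of TRIAGE-r1-1).
* `stub_accumulation` — the abstract kernel of K3(a) (pure commutative algebra + `3`-adic
  analysis, provable now): in that situation `D`-points of `R` accumulate at `x` UNIFORMLY on `R`
  (minimal polynomial over the normal `Λ`, root continuity, lying over, compactness of bounded-degree
  points, separation of the finite fibre).
* `stub_quadraticDescent` — Arthur–Clozel cyclic descent `F' → K` of regular cuspidal `P'` whose
  Galois representation extends to `Γ_K`, with level, compatibility and integrality of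
  `N𝔭·Σ Satake` over `K` (Thm. 4.2 (d) + strong multiplicity one + lang.S27 + Clozel integrality).
* `stub_dictionary` — from `‖tr ρ_y − tr ρ_C‖ ≤ 3^{-k}` on `Γ_K`, Frobenius compatibility of `Π`
  with `ρ_y` and the trace identity of `ρ_C` to the crux's typed `ℤ̄_𝔐`-congruence
  (`𝔐 = {z : ‖ι⁻¹ z‖ < 1}`; valuation ring of `ℚ̄` at `𝔐` is `ℤ̄_𝔐`).
* `stub_remainder` — the conceded complement (residual image `A₄`, or not μ-ordinary at `3`):
  the crux restricted to `f` outside the main class (the route's foreseen `RTSupersingular` ∪ the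
  `A₄` case; no engine in this line — TRIAGE-r1-1 §3, refuter O1).
-/

open Literature.NumberTheory.GaloisRepresentations Literature.NumberTheory.Automorphic
open IsDedekindDomain NumberField Polynomial

set_option linter.dupNamespace false

namespace Summit.Langlands.Langlands.Cruxes.MuOrdinaryFamilyRT.WeightBlindLambdaAdicRt

/-! ## The six stubs -/

/-- **Stub A — the Galois input (`ρ_C` and its Frobenius traces).**  For a separable quartic
`f ∈ ℤ[X]` with `12 ∣ #Gal(f)` there are a field isomorphism `ι : ℚ̄₃ ≃ ℂ`, an embedding
`e : K → ℂ`, a finite set `S₀` of finite places of `K = ℚ(ω)` containing every place above `3`, and a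
continuous `ρ : Γ_K → GL₃(ℚ̄₃)` (intended: `T_λ J(C) ⊗ ℚ̄₃`, the `ω`-eigenpart of the `3`-adic Tate
module of the Jacobian of `C : y³ = f(x)`, read through `e`/`ι`) which is absolutely irreducible
(its reduction is the reflection representation of `Gal(f) ∈ {A₄, S₄}` on `𝔽₃⁴/diag`,
Poonen–Schaefer / Upton; an absolutely irreducible reduction forces absolute irreducibility),
unramified at every `𝔭 ∉ S₀`, and whose GEOMETRIC Frobenius at `𝔭 ∉ S₀` has trace
`ι⁻¹(e(a_𝔭(f)))`, `a_𝔭(f) = picardTrace f 𝔭 = -∑_x χ_𝔭(f(x))` (Lefschetz trace formula on the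
`ω`-eigenpart of `H¹`: `#C(k_𝔭) = N𝔭 + 1 + S_χ + S_χ̄`; the sign/eigenpart convention is absorbed by
the choice of `e`, as in the crux).  Size L (Jacobian/Tate module absent from Mathlib; the tree has
`SuperellipticTorsionRep`, `CubicResidueSymbol`). -/
theorem stub_picardGaloisInput :
    ∀ (f : ℤ[X]), f.natDegree = 4 → (f.map (Int.castRingHom ℚ)).Separable →
      12 ∣ Nat.card (f.map (Int.castRingHom ℚ)).Gal →
    ∃ (ι : PadicAlgCl 3 ≃+* ℂ) (e : CyclotomicField 3 ℚ →+* ℂ)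
      (S₀ : Finset (HeightOneSpectrum (𝓞 (CyclotomicField 3 ℚ))))
      (ρ : FramedGaloisRep (CyclotomicField 3 ℚ) (PadicAlgCl 3) 3),
      (∀ v : HeightOneSpectrum (𝓞 (CyclotomicField 3 ℚ)),
        ((3 : ℕ) : 𝓞 (CyclotomicField 3 ℚ)) ∈ v.asIdeal → v ∈ S₀) ∧
      FramedRep.IsAbsolutelyIrreducible ρ ∧
      ∀ 𝔭 ∉ S₀, ρ.IsUnramifiedAt 𝔭 ∧
        ∀ 𝔓 ∈ 𝔭.primesAbove, ∀ τ : Field.absoluteGaloisGroup (CyclotomicField 3 ℚ),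
          IsArithFrobAt (𝓞 (CyclotomicField 3 ℚ)) τ 𝔓 →
            FramedRep.trace ρ τ⁻¹ = ι.symm (e (picardTrace f 𝔭)) := by
  sorry

/-- **Stub B — THE LEVER: a dominating, σ-fixed `Λ`-adic ordinary family through `ρ_C` whose
arithmetic points are automorphic over `F' = K(√d)`** (card K1 + K2, and the crux-level upgrade
(β) demanded by TRIAGE-r1-1).  MAIN CLASS: `f` has μ-ordinary (`3`-rank `2`, `λ`-distinguished)
potentially good reduction at `3` and the image of `ρ̄_C|Γ_K` is all of `S₄`
(`disc f ∉ ℚ^{×2} ∪ -3·ℚ^{×2}`).  Given the Galois input of Stub A, there exist: a quadratic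
extension `F'/K` (intended `F' = K(√d)`, `d ∈ {6, 15, 33, …}` with `ℚ₃(√d) = K_λ` and
`d, -3d ∉ disc(f)·ℚ^{×2}`, so that `λ` splits in `F'`, `F'_w = K_λ`, the definite unitary group
`U(3)_{F'/ℚ(√d)}` is `GL₃(K_λ)` at the unique prime of `ℚ(√d)` above `3`, and `ρ̄_C(Γ_{F'}) = S₄`),
a level `S'` above `S₀`, a Noetherian integrally closed domain `Λ` (the component
`𝒪⟦X₁,X₂,X₃⟧` of the polarized ordinary weight algebra `Λ_K` carrying `ρ_C`), a finite
`Λ`-algebra `R` (the polarized `Λ`-ordinary deformation ring `R_K` of `ρ̄_C` unramified outside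
`S₀`, or its reduced Hecke quotient), a trace function `T : Γ_K → R` (universal trace), a point
`x : R → ℚ̄₃` with `x ∘ T = tr ρ` (this is K2: `ρ_C|Γ_{K_λ}` is `Λ`-ordinary — the
connected–local-local–étale filtration of `J[3^∞]` over the good-reduction field is
`Γ_{K_λ}`-stable with `𝒪_{K_λ}`-rank-one graded pieces, TRIAGE-r1-1 "H_ab automatic"), a prime
`𝔮 ⊆ ker x` with `𝔮 ∩ Λ = 0` — (β): THE COMPONENT OF `Spec R_K` THROUGH `x_C` DOMINATES `Spec Λ_K`
(not implied by `R_{F'}^{red} = T_{F'}`: σ-equivariant patching with TW sets stable under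
`Gal(ℚ(√d)/ℚ)`, or `3`-adic cyclic descent of the ordinary family along `F'/K`) —, integrality of
`x` on `Λ`, a set `D` of `Λ`-points with values in the integers of one finite `E/ℚ₃` (the
arithmetic points: regular dominant algebraic weights times the finite-order part of the weight of
`ρ_C`, e.g. Hodge–Tate types `(2·3^m - 1, 3^m - 1, 0) → (-1,-1,0)`) accumulating UNIFORMLY at the
weight `x|Λ` of `ρ_C`, and CLASSICALITY of arithmetic points: every point `y` of `R` over `D` is
`tr ρ_y` for a continuous `ρ_y : Γ_K → GL₃(ℚ̄₃)`, absolutely irreducible on `Γ_{F'}`, whose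
restriction to `Γ_{F'}` is attached (lang.S27 compatibility at every `w ∉ S'`, `w ∤ 3`) to a
regular algebraic cuspidal `P'_y` of `GL₃(𝔸_{F'})` unramified outside `S'` — Geraghty's `Λ`-adic
ordinary `R^{red} = T` for the definite `U(3)` over `ℚ(√d)` at the split prime `3` (`p = n = 3`,
`ζ₃ ∈ F'`: generator/relation count off by `h⁰(ad ρ̄(1)) = 1`, TW primes `q ≡ 1 mod 3^N` with an
`𝔽₉`-rational distinguished eigenvalue; `S₄` is `ad/𝔷`-adequate over `𝔽₉`, kit j007087/j007470),
Hida's control theorem at regular dominant arithmetic weights, Labesse/Rogawski base change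
`U(3) → GL₃/F'` (cuspidal since `ρ_y|Γ_{F'}` is irreducible).  The residual seed (`T_𝔪 ≠ 0`) is
free: Langlands–Tunnell/Deligne–Serre + `Sym²` + base change, resp. CM cubic induction (route
support items `ResidualAutomorphyOdd/Even`), made ordinary at `λ` and polarized.  Size XL. -/
theorem stub_sigmaFixedOrdinaryFamily :
    ∀ (f : ℤ[X]), f.natDegree = 4 → (f.map (Int.castRingHom ℚ)).Separable →
      12 ∣ Nat.card (f.map (Int.castRingHom ℚ)).Gal →
      Literature.AlgebraicGeometry.Motives.HasMuOrdinaryReductionAtThree f →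
      ¬ IsSquare (f.map (Int.castRingHom ℚ)).discr →
      ¬ IsSquare ((-3 : ℚ) * (f.map (Int.castRingHom ℚ)).discr) →
    ∀ (ι : PadicAlgCl 3 ≃+* ℂ) (e : CyclotomicField 3 ℚ →+* ℂ)
      (S₀ : Finset (HeightOneSpectrum (𝓞 (CyclotomicField 3 ℚ))))
      (ρ : FramedGaloisRep (CyclotomicField 3 ℚ) (PadicAlgCl 3) 3),
      (∀ v : HeightOneSpectrum (𝓞 (CyclotomicField 3 ℚ)),
        ((3 : ℕ) : 𝓞 (CyclotomicField 3 ℚ)) ∈ v.asIdeal → v ∈ S₀) →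
      FramedRep.IsAbsolutelyIrreducible ρ →
      (∀ 𝔭 ∉ S₀, ρ.IsUnramifiedAt 𝔭 ∧
        ∀ 𝔓 ∈ 𝔭.primesAbove, ∀ τ : Field.absoluteGaloisGroup (CyclotomicField 3 ℚ),
          IsArithFrobAt (𝓞 (CyclotomicField 3 ℚ)) τ 𝔓 →
            FramedRep.trace ρ τ⁻¹ = ι.symm (e (picardTrace f 𝔭))) →
    ∃ (F' : Type) (_ : Field F') (_ : NumberField F') (_ : Algebra (CyclotomicField 3 ℚ) F')
      (hcpt' : isCompact_glFiniteIntegralLevel 3 F')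
      (S' : Finset (HeightOneSpectrum (𝓞 F')))
      (Λ : Type) (_ : CommRing Λ) (_ : IsDomain Λ) (_ : IsNoetherianRing Λ)
      (_ : IsIntegrallyClosed Λ)
      (R : Type) (_ : CommRing R) (_ : Algebra Λ R) (_ : Module.Finite Λ R)
      (T : Field.absoluteGaloisGroup (CyclotomicField 3 ℚ) → R) (x : R →+* PadicAlgCl 3)
      (D : Set (Λ →+* PadicAlgCl 3)) (E : IntermediateField ℚ_[3] (PadicAlgCl 3)),
      Module.finrank (CyclotomicField 3 ℚ) F' = 2 ∧ FiniteDimensional ℚ_[3] E ∧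
      (∀ w : HeightOneSpectrum (𝓞 F'), w.under (𝓞 (CyclotomicField 3 ℚ)) ∈ S₀ → w ∈ S') ∧
      (∀ g, x (T g) = FramedRep.trace ρ g) ∧
      (∃ 𝔮 : Ideal R, 𝔮.IsPrime ∧ Ideal.comap (algebraMap Λ R) 𝔮 = ⊥ ∧ ∀ r ∈ 𝔮, x r = 0) ∧
      (∀ a : Λ, ‖x (algebraMap Λ R a)‖ ≤ 1) ∧
      (∀ κ ∈ D, ∀ a : Λ, κ a ∈ E ∧ ‖κ a‖ ≤ 1) ∧
      (∀ m : ℕ, ∃ κ ∈ D, ∀ a : Λ, ‖κ a - x (algebraMap Λ R a)‖ ≤ ((3 : ℝ)⁻¹) ^ m) ∧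
      (∀ y : R →+* PadicAlgCl 3, y.comp (algebraMap Λ R) ∈ D →
        ∃ ρy : FramedGaloisRep (CyclotomicField 3 ℚ) (PadicAlgCl 3) 3,
          (∀ g, FramedRep.trace ρy g = y (T g)) ∧
          FramedRep.IsAbsolutelyIrreducible (ρy.restrictField F') ∧
          ∃ P' : CuspidalAutomorphicRepData 3 F' hcpt',
            P'.1.IsRegularAlgebraic ∧
            ∀ w ∉ S', (∃ α : Multiset ℂ, P'.1.HasSatakeParamAt w α) ∧
              (((3 : ℕ) : 𝓞 F') ∉ w.asIdeal →
                IsGaloisCompatibleAt P'.1 ι (ρy.restrictField F') w)) := by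
  sorry

/-- **Stub C — accumulation of arithmetic points (abstract kernel of K3(a); pure algebra,
provable now).**  Let `Λ` be a Noetherian integrally closed domain, `R` a finite `Λ`-algebra,
`x : R → ℚ̄₃` a point integral on `Λ`, `𝔮 ⊆ ker x` a prime of `R` with `𝔮 ∩ Λ = 0` (the component
of `x` dominates `Spec Λ`), and `D` a set of `Λ`-points with values in the integers of one finite
`E/ℚ₃` which accumulates at `κ = x|Λ` uniformly on `Λ`.  Then points of `R` over `D` accumulate at
`x` UNIFORMLY on `R`.  Intended proof: `B = R/𝔮` is a domain, finite and torsion-free over the normal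
`Λ`; the fibre of `B` over `κ` is finite; choose `b ∈ B` separating `x` from the other fibre points
(a group is not a finite union of infinite-index subgroups); the minimal polynomial `F_b ∈ Λ[X]` of
`b` is monic with `Λ[b] ≅ Λ[X]/(F_b)`; for `κ' ∈ D` close to `κ`, `κ'(F_b)` has a root `β` close to
`x(b)` (root continuity, the card's first lemma `exists_root_near_of_norm_eval_le`:
`∏|x(b) - rᵢ| ≤ ε^d ⇒ |x(b) - rᵢ| ≤ ε`); `(κ', β)` is a point of `Λ[b]`, which lifts to a point `y`
of `B` (lying over + `ℚ̄₃` algebraically closed); all such `y` take values in the integers of ONE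
finite extension of `E` (degrees bounded by the number of module generators), a compact ring, so a
cluster point `y*` of the `y`'s exists, is a point of `B` over `κ` with `y*(b) = x(b)`, hence
`y* = x`; closeness on finitely many module generators plus uniform closeness of the weights on `Λ`
gives uniform closeness on `R` (ultrametric inequality, all values of norm `≤ 1`).  Size M/L. -/
theorem stub_accumulation :
    ∀ (Λ R : Type) [CommRing Λ] [IsDomain Λ] [IsNoetherianRing Λ] [IsIntegrallyClosed Λ]
      [CommRing R] [Algebra Λ R] [Module.Finite Λ R]
      (x : R →+* PadicAlgCl 3) (D : Set (Λ →+* PadicAlgCl 3))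
      (E : IntermediateField ℚ_[3] (PadicAlgCl 3)), FiniteDimensional ℚ_[3] E →
      (∃ 𝔮 : Ideal R, 𝔮.IsPrime ∧ Ideal.comap (algebraMap Λ R) 𝔮 = ⊥ ∧ ∀ r ∈ 𝔮, x r = 0) →
      (∀ a : Λ, ‖x (algebraMap Λ R a)‖ ≤ 1) →
      (∀ κ ∈ D, ∀ a : Λ, κ a ∈ E ∧ ‖κ a‖ ≤ 1) →
      (∀ m : ℕ, ∃ κ ∈ D, ∀ a : Λ, ‖κ a - x (algebraMap Λ R a)‖ ≤ ((3 : ℝ)⁻¹) ^ m) →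
    ∀ m : ℕ, ∃ y : R →+* PadicAlgCl 3, y.comp (algebraMap Λ R) ∈ D ∧
      ∀ r : R, ‖y r - x r‖ ≤ ((3 : ℝ)⁻¹) ^ m := by
  sorry

/-- **Stub D — quadratic (cyclic) descent `F' → K` with level, compatibility and integrality
(Arthur–Clozel, Ch. 3, Thm. 4.2 (d); known).**  `F'/K` quadratic, `ρ : Γ_K → GL₃(ℚ̄₃)` continuous
with `ρ|Γ_{F'}` absolutely irreducible, `P'` regular algebraic cuspidal on `GL₃(𝔸_{F'})` unramified
outside `S'` and compatible with `ρ|Γ_{F'}` at every `w ∉ S'`, `w ∤ 3`.  Then there is a regular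
algebraic cuspidal `Π` on `GL₃(𝔸_K)`, unramified outside a finite `S` depending only on
`(F'/K, S')` (intended: places under `S'`, places ramified in `F'/K`, places above `3`), whose
Hecke eigenvalue `N𝔭·Σ Satake` at every `𝔭 ∉ S` is an algebraic integer and which is compatible
with `ρ` at every `𝔭 ∉ S`, `𝔭 ∤ 3`.  Intended proof: `P'` and `P'^σ` have the same Satake parameters
at almost all `w` (both read off `charpoly ρ(Frob_w)`, `ρ` being a representation of `Γ_K ∋ σ̃`), so
`P'^σ ≅ P'` (strong multiplicity one `strong_multiplicity_one_gl`); Arthur–Clozel (d)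
(`ArthurClozel1989_cuspidal_descent` / `cuspidal_descent_cyclic`) gives cuspidal `P₀` on `GL₃(𝔸_K)`
with `BC(P₀) = P'`, regular algebraic by `ArthurClozel1989_strongLifting_archimedean`; `r(P₀)`
(lang.S27 `exists_galoisRep_of_regularAlgebraic`, `K` CM) restricts on `Γ_{F'}` to `r(P') ≅ ρ|Γ_{F'}`
(Chebotarev + Brauer–Nesbitt, irreducibility), so `r(P₀) ≅ ρ ⊗ χ^a`, `χ` the quadratic character of
`F'/K`; take `P = P₀ ⊗ η^a` (`twistByFiniteOrderChar`), unramified outside `S`; integrality of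
`N𝔭·e₁(α)` for regular algebraic cuspidal `Π` (Clozel 1990, Thm. 3.13: eigenvalues of integrally
normalised Hecke operators on cohomology).  Size L. -/
theorem stub_quadraticDescent :
    ∀ (F' : Type) [Field F'] [NumberField F'] [Algebra (CyclotomicField 3 ℚ) F'],
      Module.finrank (CyclotomicField 3 ℚ) F' = 2 →
    ∀ (hcpt : isCompact_glFiniteIntegralLevel 3 (CyclotomicField 3 ℚ))
      (hcpt' : isCompact_glFiniteIntegralLevel 3 F') (ι : PadicAlgCl 3 ≃+* ℂ)
      (S' : Finset (HeightOneSpectrum (𝓞 F'))),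
    ∃ S : Finset (HeightOneSpectrum (𝓞 (CyclotomicField 3 ℚ))),
      ∀ (ρ : FramedGaloisRep (CyclotomicField 3 ℚ) (PadicAlgCl 3) 3)
        (P' : CuspidalAutomorphicRepData 3 F' hcpt'),
        FramedRep.IsAbsolutelyIrreducible (ρ.restrictField F') →
        P'.1.IsRegularAlgebraic →
        (∀ w ∉ S', (∃ α : Multiset ℂ, P'.1.HasSatakeParamAt w α) ∧
          (((3 : ℕ) : 𝓞 F') ∉ w.asIdeal → IsGaloisCompatibleAt P'.1 ι (ρ.restrictField F') w)) →
        ∃ P : CuspidalAutomorphicRepData 3 (CyclotomicField 3 ℚ) hcpt,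
          P.1.IsRegularAlgebraic ∧
          ∀ 𝔭 ∉ S, (∃ (α : Multiset ℂ) (t₀ : integralClosure ℤ ℂ),
              P.1.HasSatakeParamAt 𝔭 α ∧ (t₀ : ℂ) = (𝔭.residueCard : ℂ) * α.sum) ∧
            (((3 : ℕ) : 𝓞 (CyclotomicField 3 ℚ)) ∉ 𝔭.asIdeal → IsGaloisCompatibleAt P.1 ι ρ 𝔭) := by
  sorry

/-- **Stub E — the dictionary to the typed `ℤ̄_𝔐`-congruence (provable now).**  For
`ι : ℚ̄₃ ≃ ℂ` put `𝔐 = {z ∈ ℤ̄ : ‖ι⁻¹ z‖ < 1}`, a maximal ideal of `ℤ̄ = integralClosure ℤ ℂ`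
containing `3` (`ℤ̄/𝔐 ↪ 𝔽̄₃`).  If `ρ` has geometric Frobenius trace `ι⁻¹(e(a_𝔭 f))` at `𝔭 ∤ 3`
(Stub A), `ρ'` has arithmetic-Frobenius characteristic polynomial `arithFrobPolyOfSatake ι N𝔭 3 α`
at `𝔭` (lang.S27 shape: roots `ι⁻¹((N𝔭·α_j)⁻¹)`, so `tr ρ'(Frob_𝔭⁻¹) = ι⁻¹(N𝔭·Σ α)`; `α_j ≠ 0`
automatically since `ρ'(Frob)` is invertible), `N𝔭·Σα = t₀ ∈ ℤ̄`, and `‖tr ρ' - tr ρ‖ ≤ 3^{-k}` on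
`Γ_K`, then `t = t₀ - e(a_𝔭 f) ∈ ℤ̄` has `‖ι⁻¹ t‖ ≤ ‖3^k‖` and hence `u·t ∈ 3^k ℤ̄` for some
`u ∈ ℤ̄ ∖ 𝔐` (the valuation ring of `ℚ̄` at the place `ι⁻¹` is the localisation `ℤ̄_𝔐`: work in the
number field `ℚ(t)`, `s = t/3^k` has `v_𝔓(s) ≥ 0` at `𝔓 = 𝔐 ∩ 𝒪`, write `s𝒪 = 𝔞𝔟⁻¹` with
`𝔟 ⊄ 𝔓` and take `u ∈ 𝔟 ∖ 𝔓`; a Frobenius at `𝔭` exists by `primesAbove_nonempty`,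
`exists_isArithFrobAt_of_mem_primesAbove_holds`).  This is the refuter's reading
`u ∉ 𝔐 ∧ u·t ∈ (3^k) ⇔ v_𝔐(t) ≥ k·v(3)` of the crux (rattack note).  Size M. -/
theorem stub_dictionary :
    ∀ (ι : PadicAlgCl 3 ≃+* ℂ) (e : CyclotomicField 3 ℚ →+* ℂ),
    ∃ 𝔐 : Ideal (integralClosure ℤ ℂ), 𝔐.IsMaximal ∧ (3 : integralClosure ℤ ℂ) ∈ 𝔐 ∧
      ∀ (k : ℕ) (f : ℤ[X]) (ρ ρ' : FramedGaloisRep (CyclotomicField 3 ℚ) (PadicAlgCl 3) 3)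
        (𝔭 : HeightOneSpectrum (𝓞 (CyclotomicField 3 ℚ))) (α : Multiset ℂ)
        (t₀ : integralClosure ℤ ℂ),
        ((3 : ℕ) : 𝓞 (CyclotomicField 3 ℚ)) ∉ 𝔭.asIdeal →
        (ρ.IsUnramifiedAt 𝔭 ∧
          ∀ 𝔓 ∈ 𝔭.primesAbove, ∀ τ : Field.absoluteGaloisGroup (CyclotomicField 3 ℚ),
            IsArithFrobAt (𝓞 (CyclotomicField 3 ℚ)) τ 𝔓 →
              FramedRep.trace ρ τ⁻¹ = ι.symm (e (picardTrace f 𝔭))) →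
        ρ'.HasFrobCharpolyAt 𝔭 (arithFrobPolyOfSatake ι 𝔭.residueCard 3 α) →
        (t₀ : ℂ) = (𝔭.residueCard : ℂ) * α.sum →
        (∀ g, ‖FramedRep.trace ρ' g - FramedRep.trace ρ g‖ ≤ ((3 : ℝ)⁻¹) ^ k) →
        ∃ (t u : integralClosure ℤ ℂ),
          (t : ℂ) = (𝔭.residueCard : ℂ) * α.sum - e (picardTrace f 𝔭) ∧
          u ∉ 𝔐 ∧ u * t ∈ Ideal.span {(3 : integralClosure ℤ ℂ) ^ k} := by
  sorry

open scoped Classical in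
/-- **Stub F — the conceded remainder (residual image `A₄`, or not μ-ordinary at `3`).**  The crux
verbatim, restricted to `f` OUTSIDE the main class of Stub B: `Gal(f) = A₄`, or `Gal(f) = S₄` with
`K ⊂ split(f)` (image of `ρ̄_C|Γ_K` is `A₄`: every adequacy clause fails, `H¹(A₄, 𝔽₃) ≠ 0`,
kit j007087/j007470 — Skinner–Wiles-type nice-prime patching / crux ideas `free-seed-smooth-rt`,
`cubic-resolvent-height-one-patching` would be the engines), or `f` without μ-ordinary
`λ`-distinguished potentially good reduction at `3` (`λ`-supersingular `y³ - y = x⁴` type or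
not-potentially-good members: no engine in any line, refuter O1; the route's foreseen second-layer
item `RTSupersingular`).  Filed as ONE stub so that the skeleton concludes the crux as typed; it is
crux-sized on its domain and is NOT expected to be proved inside this line (lead: `promote-stub`
to the planner, who files the route's `RTMuOrdinary`/`RTSupersingular` split, kill criterion 4). -/
theorem stub_remainder :
    ∀ (f : ℤ[X])
      (hcpt : isCompact_glFiniteIntegralLevel 3 (CyclotomicField 3 ℚ)),
      f.natDegree = 4 → (f.map (Int.castRingHom ℚ)).Separable →
      12 ∣ Nat.card (f.map (Int.castRingHom ℚ)).Gal →
      ¬ (Literature.AlgebraicGeometry.Motives.HasMuOrdinaryReductionAtThree f ∧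
          ¬ IsSquare (f.map (Int.castRingHom ℚ)).discr ∧
          ¬ IsSquare ((-3 : ℚ) * (f.map (Int.castRingHom ℚ)).discr)) →
      (∃ (P : CuspidalAutomorphicRepData 3 (CyclotomicField 3 ℚ) hcpt)
          (𝔐 : Ideal (integralClosure ℤ ℂ)), P.1.IsRegularAlgebraic ∧ 𝔐.IsMaximal ∧
          (3 : (integralClosure ℤ ℂ)) ∈ 𝔐 ∧
          ∀ᶠ 𝔭 : HeightOneSpectrum (𝓞 (CyclotomicField 3 ℚ)) in Filter.cofinite,
            ∃ (α : Multiset ℂ) (Q : Polynomial (integralClosure ℤ ℂ)),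
              P.1.HasSatakeParamAt 𝔭 α ∧
              Q.map (algebraMap (integralClosure ℤ ℂ) ℂ) =
                (α.map (fun a => Polynomial.X - Polynomial.C ((𝔭.residueCard : ℂ) * a))).prod ∧
              Q.map (Ideal.Quotient.mk 𝔐) =
                (if (f.map ((Ideal.Quotient.mk 𝔭.asIdeal).comp
                      (algebraMap ℤ (𝓞 (CyclotomicField 3 ℚ))))).roots.toFinset.card = 4
                  then (Polynomial.X - 1) ^ 3
                  else if (f.map ((Ideal.Quotient.mk 𝔭.asIdeal).comp
                      (algebraMap ℤ (𝓞 (CyclotomicField 3 ℚ))))).roots.toFinset.card = 2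
                  then (Polynomial.X - 1) ^ 2 * (Polynomial.X + 1)
                  else if (f.map ((Ideal.Quotient.mk 𝔭.asIdeal).comp
                      (algebraMap ℤ (𝓞 (CyclotomicField 3 ℚ))))).roots.toFinset.card = 1
                  then Polynomial.X ^ 3 - 1
                  else if (∃ y : ((𝓞 (CyclotomicField 3 ℚ)) ⧸ 𝔭.asIdeal),
                      y ^ 2 = (f.map ((Ideal.Quotient.mk 𝔭.asIdeal).comp
                        (algebraMap ℤ (𝓞 (CyclotomicField 3 ℚ))))).discr)
                  then (Polynomial.X - 1) * (Polynomial.X + 1) ^ 2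
                  else Polynomial.X ^ 3 + Polynomial.X ^ 2 + Polynomial.X + 1 : Polynomial ℤ).map
                  (Int.castRingHom ((integralClosure ℤ ℂ) ⧸ 𝔐))) →
      ∃ (e : CyclotomicField 3 ℚ →+* ℂ) (𝔐 : Ideal (integralClosure ℤ ℂ))
        (S : Finset (HeightOneSpectrum (𝓞 (CyclotomicField 3 ℚ)))),
        𝔐.IsMaximal ∧ (3 : (integralClosure ℤ ℂ)) ∈ 𝔐 ∧
        ∀ k : ℕ, ∃ P : CuspidalAutomorphicRepData 3 (CyclotomicField 3 ℚ) hcpt,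
          P.1.IsRegularAlgebraic ∧
          ∀ 𝔭 ∉ S, ∃ (α : Multiset ℂ) (t u : (integralClosure ℤ ℂ)),
            P.1.HasSatakeParamAt 𝔭 α ∧
            (t : ℂ) = (𝔭.residueCard : ℂ) * α.sum - e (picardTrace f 𝔭) ∧
            u ∉ 𝔐 ∧ u * t ∈ Ideal.span {(3 : (integralClosure ℤ ℂ)) ^ k} := by
  sorry

/-! ## The composition: the six stubs imply the crux, by name -/

/-- **The line concludes the crux.**  `MuOrdinaryFamilyRT` for every generic `f`: outside the
main class by `stub_remainder` (which consumes the crux's residual hypothesis); inside it by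
`stub_picardGaloisInput` (ρ_C) → `stub_sigmaFixedOrdinaryFamily` (the dominating family and
classicality over `F'`) → `stub_accumulation` (for each `k`, an arithmetic point `y_k` with
`‖y_k - x_C‖ ≤ 3^{-k}` on `R`, so `‖tr ρ_{y_k} - tr ρ_C‖ ≤ 3^{-k}` on `Γ_K`) →
`stub_quadraticDescent` (`P_k` on `GL₃(𝔸_K)`, level `S`, integral, compatible with `ρ_{y_k}`) →
`stub_dictionary` (the typed congruence at every `𝔭 ∉ S ∪ S₀`).  Kernel-checked; the only `sorry`s
are inside the six stubs.  The residual hypothesis of the crux is used only in the remainder case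
(inside the main class the polarized ordinary seed is free, Stub B). -/
theorem MuOrdinaryFamilyRT_of :
    Summit.Langlands.Langlands.Theses.PicardMuOrdinary.MuOrdinaryFamilyRT := by
  intro f hcpt hdeg hsep hgal hres
  classical
  by_cases hM : (Literature.AlgebraicGeometry.Motives.HasMuOrdinaryReductionAtThree f ∧
      ¬ IsSquare (f.map (Int.castRingHom ℚ)).discr ∧
      ¬ IsSquare ((-3 : ℚ) * (f.map (Int.castRingHom ℚ)).discr))
  swap
  · exact stub_remainder f hcpt hdeg hsep hgal hM hres
  obtain ⟨hmu, hd1, hd2⟩ := hM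
  -- Stub A: the Picard representation and its Frobenius traces
  obtain ⟨ι, e, S₀, ρ, hS₀, hirr, htr⟩ := stub_picardGaloisInput f hdeg hsep hgal
  -- Stub B: the dominating σ-fixed ordinary family through ρ_C, classical over F' on D-points
  obtain ⟨F', _instF, _instNF, _instA, hcpt', S', Λ, _i1, _i2, _i3, _i4, R, _i5, _i6, _i7, T, x,
      D, E, hdegF', hE, hS', hxT, hdom, hxint, hDint, hDacc, hclass⟩ :=
    stub_sigmaFixedOrdinaryFamily f hdeg hsep hgal hmu hd1 hd2 ι e S₀ ρ hS₀ hirr htr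
  -- Stub D: the descent datum (a level S over K, uniform in the point)
  obtain ⟨S, hdesc⟩ := stub_quadraticDescent F' hdegF' hcpt hcpt' ι S'
  -- Stub E: the maximal ideal 𝔐 of ℤ̄ cut out by ι
  obtain ⟨𝔐, h𝔐max, h𝔐3, hdict⟩ := stub_dictionary ι e
  refine ⟨e, 𝔐, S ∪ S₀, h𝔐max, h𝔐3, fun k => ?_⟩
  -- Stub C: an arithmetic point y of R with ‖y - x‖ ≤ 3^{-k} uniformly on R
  obtain ⟨y, hyD, hyx⟩ := stub_accumulation Λ R x D E hE hdom hxint hDint hDacc k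
  obtain ⟨ρy, hρyT, hρyirr, P', hP'reg, hP'⟩ := hclass y hyD
  obtain ⟨P, hPreg, hP⟩ := hdesc ρy P' hρyirr hP'reg hP'
  refine ⟨P, hPreg, fun 𝔭 h𝔭 => ?_⟩
  have h𝔭S : 𝔭 ∉ S := fun h => h𝔭 (Finset.mem_union_left _ h)
  have h𝔭S₀ : 𝔭 ∉ S₀ := fun h => h𝔭 (Finset.mem_union_right _ h)
  have h3 : ((3 : ℕ) : 𝓞 (CyclotomicField 3 ℚ)) ∉ 𝔭.asIdeal := fun h => h𝔭S₀ (hS₀ 𝔭 h)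
  obtain ⟨⟨α, t₀, hα, ht₀⟩, hcomp⟩ := hP 𝔭 h𝔭S
  have happrox : ∀ g, ‖FramedRep.trace ρy g - FramedRep.trace ρ g‖ ≤ ((3 : ℝ)⁻¹) ^ k := by
    intro g
    rw [hρyT g, ← hxT g]
    exact hyx (T g)
  obtain ⟨t, u, ht, hu, hut⟩ :=
    hdict k f ρ ρy 𝔭 α t₀ h3 (htr 𝔭 h𝔭S₀) ((hcomp h3) α hα).2 ht₀ happrox
  exact ⟨α, t, u, hα, ht, hu, hut⟩

end Summit.Langlands.Langlands.Cruxes.MuOrdinaryFamilyRT.WeightBlindLambdaAdicRt
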